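import Mathlib
import Literature.NumberTheory.LFunctions.Zhang2022.Section11AFELineIntegrability
import HarnessLib

/-!
# Zhang (2022) §11, proof of Lemma 11.2 for `χψ` — tools for the contour move (6.5): Gaussian tails,
# the regularised `I″`-integrand and the rectangle `[−1,0] × [−𝓛²⁰, 𝓛²⁰]`

Topic `Literature/NumberTheory/LFunctions/Zhang2022` (Landau–Siegel audit tree; verdict-neutral).
Y. Zhang, arXiv:2211.02515v1 (2022) [Zhang2022LandauSiegel] — **an unrefereed manuscript under
adjudication** (campaign D-0069; nothing here bears on Theorems 1–2 or on Landau–Siegel zeros).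
Companion of `Section11AFEObjects` / `Section11AFELineIntegrability`. PROVED: `gauss_tail_quad_le`
(`∫_{|v|>V}(|v|+A)²e^{−βv²} ≤ e^{−βV²/2}((4/β)√(4π/β) + 2A²√(2π/β))`), `diffReg` (the `I″`-integrand
`((Z(s+w,χψ) − Z(s,χψ)R^{−w})/w)·head·X^wω₁` continued through `w = 0`) with
`differentiableOn_diffReg` (holomorphic on `Im(s+w) > 0`) and `rect_diffReg` (Cauchy on the
rectangle: `∫_{−V}^{V}F(−1+iy) − ∫_{−V}^{V}F(iy) = −i(∫_{−1}^{0}F(x−iV) − ∫_{−1}^{0}F(x+iV))`,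
Mathlib's `integral_boundary_rect_eq_zero_of_differentiableOn`).
[cite: Zhang2022LandauSiegel, §6 Lemma 6.1 (proof) (6.5) p. 32; §11 Lemma 11.2 p. 65]
-/

noncomputable section

open Complex Real ComplexConjugate MeasureTheory Set Filter Topology

namespace Literature.NumberTheory.LFunctions.Zhang2022.Section11AFE

open Skeleton GaussWeight Section6Statements

/-! ## §1. Block (f): moving the segment `u = −1`, `|v| ≤ 𝓛²⁰` to `u = 0` — Gaussian tails and
the rectangle -/

section BlockF

variable {D : ℕ} [NeZero D] (χ : DirichletCharacter ℂ D) (x : Chr D)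

omit [NeZero D] in
/-- A quadratic times a Gaussian is integrable on `ℝ` (the "trivial bound for `ω₁(w)`" bookkeeping,
§6 p. 32). [cite: Zhang2022LandauSiegel, §6 p. 32, tex L1746] -/
theorem integrable_absAddSq_mul_gauss {b : ℝ} (hb : 0 < b) (A : ℝ) :
    Integrable fun v : ℝ => (|v| + A) ^ 2 * Real.exp (-b * v ^ 2) := by
  have h2 : Integrable fun v : ℝ => v ^ 2 * Real.exp (-b * v ^ 2) := by
    have := integrable_rpow_mul_exp_neg_mul_sq hb (s := 2) (by norm_num)
    refine this.congr (ae_of_all _ fun v => ?_)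
    simp only [Real.rpow_two]
  have h1 : Integrable fun v : ℝ => |v| * Real.exp (-b * v ^ 2) := by
    have := (integrable_rpow_mul_exp_neg_mul_sq hb (s := 1) (by norm_num)).norm
    refine this.congr (ae_of_all _ fun v => ?_)
    simp only [Real.rpow_one, Real.norm_eq_abs, abs_mul, abs_of_pos (Real.exp_pos _)]
  have h0 := integrable_exp_neg_mul_sq hb
  have e : (fun v : ℝ => (|v| + A) ^ 2 * Real.exp (-b * v ^ 2)) = fun v =>
      v ^ 2 * Real.exp (-b * v ^ 2) + 2 * A * (|v| * Real.exp (-b * v ^ 2)) +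
        A ^ 2 * Real.exp (-b * v ^ 2) := by
    funext v
    have : (|v| + A) ^ 2 = v ^ 2 + 2 * A * |v| + A ^ 2 := by rw [add_sq, sq_abs]; ring
    rw [this]; ring
  rw [e]
  exact (h2.add (h1.const_mul _)).add (h0.const_mul _)

omit [NeZero D] in
/-- `u e^{−u/2} ≤ 1` for `u ≥ 0` (`e^{u/2} ≥ (1 + u/4)² ≥ u`). [folklore] -/
private theorem mul_exp_neg_half_le {u : ℝ} (hu : 0 ≤ u) : u * Real.exp (-(u / 2)) ≤ 1 := by
  have h1 : 1 + u / 4 ≤ Real.exp (u / 4) := by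
    have := Real.add_one_le_exp (u / 4); linarith
  have h2 : u ≤ Real.exp (u / 2) := by
    have hsq : Real.exp (u / 2) = Real.exp (u / 4) ^ 2 := by
      rw [← Real.exp_nat_mul]; congr 1; ring
    rw [hsq]
    have h0 : 0 ≤ 1 + u / 4 := by linarith
    calc u ≤ (1 + u / 4) ^ 2 := by nlinarith [sq_nonneg (1 - u / 4)]
      _ ≤ Real.exp (u / 4) ^ 2 := pow_le_pow_left₀ h0 h1 2
  rw [Real.exp_neg]
  have hpos : 0 < Real.exp (u / 2) := Real.exp_pos _
  rw [mul_inv_le_iff₀ hpos, one_mul]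
  exact h2

omit [NeZero D] in
/-- `v²e^{−γv²} ≤ γ⁻¹e^{−γv²/2}` (`γ > 0`). [folklore] -/
private theorem sq_mul_gauss_le {γ : ℝ} (hγ : 0 < γ) (v : ℝ) :
    v ^ 2 * Real.exp (-γ * v ^ 2) ≤ γ⁻¹ * Real.exp (-(γ / 2) * v ^ 2) := by
  have hu : 0 ≤ γ * v ^ 2 := by positivity
  have h := mul_exp_neg_half_le hu
  have e : Real.exp (-γ * v ^ 2) = Real.exp (-(γ * v ^ 2 / 2)) * Real.exp (-(γ / 2) * v ^ 2) := by
    rw [← Real.exp_add]; congr 1; ring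
  rw [e]
  have hγ' : γ⁻¹ * (γ * v ^ 2 * Real.exp (-(γ * v ^ 2 / 2))) ≤ γ⁻¹ * 1 :=
    mul_le_mul_of_nonneg_left h (inv_nonneg.mpr hγ.le)
  calc v ^ 2 * (Real.exp (-(γ * v ^ 2 / 2)) * Real.exp (-(γ / 2) * v ^ 2))
      = γ⁻¹ * (γ * v ^ 2 * Real.exp (-(γ * v ^ 2 / 2))) * Real.exp (-(γ / 2) * v ^ 2) := by
        field_simp
    _ ≤ γ⁻¹ * 1 * Real.exp (-(γ / 2) * v ^ 2) := by gcongr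
    _ = γ⁻¹ * Real.exp (-(γ / 2) * v ^ 2) := by ring

omit [NeZero D] in
/-- **Gaussian tail with a quadratic weight**: for `β > 0`, `A ≥ 0`, `V ≥ 0` and the complement `S`
of `(−V, V]`, `∫_S (|v|+A)²e^{−βv²}dv ≤ e^{−βV²/2}·((4/β)√(4π/β) + 2A²√(2π/β))` ("By a trivial bound
for `ω₁(w)` … the integrals on the segments `u = −1`, `|v| > 𝓛²⁰` contribute `≪ ε`", §6 p. 32).
[cite: Zhang2022LandauSiegel, §6 p. 32, tex L1746] -/
theorem gauss_tail_quad_le {β : ℝ} (hβ : 0 < β) (A : ℝ) {V : ℝ} (hV : 0 ≤ V) :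
    ∫ v in (Set.Ioc (-V) V)ᶜ, (|v| + A) ^ 2 * Real.exp (-β * v ^ 2) ≤
      Real.exp (-(β / 2) * V ^ 2) *
        (4 / β * Real.sqrt (π / (β / 4)) + 2 * A ^ 2 * Real.sqrt (π / (β / 2))) := by
  set S : Set ℝ := (Set.Ioc (-V) V)ᶜ with hS
  have hSm : MeasurableSet S := measurableSet_Ioc.compl
  -- the majorant on `S`
  set g : ℝ → ℝ := fun v => Real.exp (-(β / 2) * V ^ 2) *
    (4 / β * Real.exp (-(β / 4) * v ^ 2) + 2 * A ^ 2 * Real.exp (-(β / 2) * v ^ 2)) with hg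
  have hgi : Integrable g := by
    have h1 := integrable_exp_neg_mul_sq (b := β / 4) (by positivity)
    have h2 := integrable_exp_neg_mul_sq (b := β / 2) (by positivity)
    exact ((h1.const_mul _).add (h2.const_mul _)).const_mul _
  have hfi : Integrable fun v : ℝ => (|v| + A) ^ 2 * Real.exp (-β * v ^ 2) :=
    integrable_absAddSq_mul_gauss hβ A
  have hle : ∀ v ∈ S, (|v| + A) ^ 2 * Real.exp (-β * v ^ 2) ≤ g v := by
    intro v hv
    have hvV : V ≤ |v| := by
      rw [hS, Set.mem_compl_iff, Set.mem_Ioc, not_and_or, not_lt, not_le] at hv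
      rcases hv with h | h
      · rw [abs_of_nonpos (by linarith)]; linarith
      · rw [abs_of_pos (by linarith)]; linarith
    have hsplit : Real.exp (-β * v ^ 2) = Real.exp (-(β / 2) * v ^ 2) * Real.exp (-(β / 2) * v ^ 2) := by
      rw [← Real.exp_add]; congr 1; ring
    have hV2 : Real.exp (-(β / 2) * v ^ 2) ≤ Real.exp (-(β / 2) * V ^ 2) := by
      refine Real.exp_le_exp.mpr ?_
      have : V ^ 2 ≤ v ^ 2 := by rw [← sq_abs v]; exact pow_le_pow_left₀ hV hvV 2
      nlinarith
    have hq : (|v| + A) ^ 2 ≤ 2 * v ^ 2 + 2 * A ^ 2 := by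
      rw [← sq_abs v]; nlinarith [sq_nonneg (|v| - A)]
    have hsq := sq_mul_gauss_le (γ := β / 2) (by positivity) v
    rw [show -(β / 2 / 2) = -(β / 4) by ring] at hsq
    calc (|v| + A) ^ 2 * Real.exp (-β * v ^ 2)
        = (|v| + A) ^ 2 * Real.exp (-(β / 2) * v ^ 2) * Real.exp (-(β / 2) * v ^ 2) := by
          rw [hsplit]; ring
      _ ≤ (2 * v ^ 2 + 2 * A ^ 2) * Real.exp (-(β / 2) * v ^ 2) * Real.exp (-(β / 2) * V ^ 2) := by
          gcongr
      _ = Real.exp (-(β / 2) * V ^ 2) *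
            (2 * (v ^ 2 * Real.exp (-(β / 2) * v ^ 2)) + 2 * A ^ 2 * Real.exp (-(β / 2) * v ^ 2)) := by
          ring
      _ ≤ Real.exp (-(β / 2) * V ^ 2) *
            (2 * ((β / 2)⁻¹ * Real.exp (-(β / 4) * v ^ 2)) + 2 * A ^ 2 * Real.exp (-(β / 2) * v ^ 2)) := by
          gcongr
      _ = g v := by rw [hg]; field_simp; ring
  calc ∫ v in S, (|v| + A) ^ 2 * Real.exp (-β * v ^ 2)
      ≤ ∫ v in S, g v := setIntegral_mono_on hfi.integrableOn hgi.integrableOn hSm hle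
    _ ≤ ∫ v, g v := setIntegral_le_integral hgi (ae_of_all _ fun v => by rw [hg]; positivity)
    _ = Real.exp (-(β / 2) * V ^ 2) *
          (4 / β * Real.sqrt (π / (β / 4)) + 2 * A ^ 2 * Real.sqrt (π / (β / 2))) := by
        rw [hg, integral_const_mul, integral_add ((integrable_exp_neg_mul_sq (by positivity)).const_mul _)
          ((integrable_exp_neg_mul_sq (by positivity)).const_mul _), integral_const_mul,
          integral_const_mul, integral_gaussian, integral_gaussian]

/-- The regularised `I″`-integrand: `((Z(s+w,χψ) − Z(s,χψ)R^{−w})/w)·head(w)·X^wω₁(w)` with the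
difference quotient continued through `w = 0` (where the numerator vanishes).
[cite: Zhang2022LandauSiegel, §6 (6.5) p. 32] -/
def diffReg (X N : ℝ) (s w : ℂ) : ℂ :=
  dslope (fun w => Zpc χ x (s + w) - Zpc χ x s * ((bigR D : ℝ) : ℂ) ^ (-w)) 0 w *
    (headPc χ x N s w * (((X : ℝ) : ℂ) ^ w * omega1 (ell D ^ 30) w))

/-- Off `w = 0` the regularised integrand is the `I″`-integrand. [cite: Zhang2022LandauSiegel, §6 (6.5)] -/
theorem diffReg_eq_integrandDiff (X N : ℝ) (s : ℂ) {w : ℂ} (hw : w ≠ 0) :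
    diffReg χ x X N s w = integrandDiff χ x X N s w := by
  have hds : dslope (fun w => Zpc χ x (s + w) - Zpc χ x s * ((bigR D : ℝ) : ℂ) ^ (-w)) 0 w =
      (Zpc χ x (s + w) - Zpc χ x s * ((bigR D : ℝ) : ℂ) ^ (-w)) / w := by
    rw [dslope_of_ne _ hw, slope_def_field, sub_zero]
    simp
  rw [diffReg, hds, integrandDiff, kern]
  field_simp

/-- The regularised `I″`-integrand is holomorphic on `Im(s + w) > 0` (for `D ≥ 3`, `R > 0`).
[cite: Zhang2022LandauSiegel, §6 (6.5) p. 32] -/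
theorem differentiableOn_diffReg {s : ℂ} (hsim : 0 < s.im)
    {X : ℝ} (hX : 0 < X) (hR : 0 < bigR D) (N : ℝ) :
    DifferentiableOn ℂ (diffReg χ x X N s) {w : ℂ | -s.im < w.im} := by
  set U : Set ℂ := {w : ℂ | -s.im < w.im} with hU
  have hUo : IsOpen U := isOpen_lt continuous_const Complex.continuous_im
  have h0U : (0 : ℂ) ∈ U := by simp [hU, hsim]
  have hRne : ((bigR D : ℝ) : ℂ) ≠ 0 := Complex.ofReal_ne_zero.mpr hR.ne'
  have hXne : ((X : ℝ) : ℂ) ≠ 0 := Complex.ofReal_ne_zero.mpr hX.ne'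
  set Ψ : ℂ → ℂ := fun w => Zpc χ x (s + w) - Zpc χ x s * ((bigR D : ℝ) : ℂ) ^ (-w) with hΨ
  have hΨd : DifferentiableOn ℂ Ψ U := by
    intro w hw
    have him : 0 < (s + w).im := by simp [hU] at hw; simp; linarith
    have h1 : DifferentiableAt ℂ (fun w => Zpc χ x (s + w)) w := by
      have hz := GammaFactor.differentiableAt_Zfac (psiChi χ x) him
      exact DifferentiableAt.comp (g := Zpc χ x) w hz ((differentiableAt_const s).add differentiableAt_id)
    have h2 : DifferentiableAt ℂ (fun w : ℂ => Zpc χ x s * ((bigR D : ℝ) : ℂ) ^ (-w)) w :=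
      (differentiableAt_const _).mul (DifferentiableAt.const_cpow differentiableAt_id.neg (Or.inl hRne))
    exact (h1.sub h2).differentiableWithinAt
  have hds : DifferentiableOn ℂ (dslope Ψ 0) U := by
    intro w hw
    by_cases hw0 : w = 0
    · subst hw0
      obtain ⟨p, hp⟩ := hΨd.analyticAt (hUo.mem_nhds h0U)
      exact hp.has_fpower_series_dslope_fslope.analyticAt.differentiableAt.differentiableWithinAt
    · exact ((differentiableAt_dslope_of_ne hw0).mpr
        ((hΨd w hw).differentiableAt (hUo.mem_nhds hw))).differentiableWithinAt
  have hH : Differentiable ℂ fun w : ℂ => headPc χ x N s w := by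
    unfold headPc
    refine Differentiable.fun_sum fun n hn => ?_
    have hn0 : (n : ℂ) ≠ 0 := by
      have := (Finset.mem_Ico.mp hn).1; exact_mod_cast (by omega : n ≠ 0)
    refine (differentiable_const _).mul ?_
    exact fun w => DifferentiableAt.const_cpow (by fun_prop) (Or.inl hn0)
  have hE : Differentiable ℂ fun w : ℂ => ((X : ℝ) : ℂ) ^ w * omega1 (ell D ^ 30) w := by
    have h1 : Differentiable ℂ fun w : ℂ => ((X : ℝ) : ℂ) ^ w :=
      fun w => DifferentiableAt.const_cpow differentiableAt_id (Or.inl hXne)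
    have h2 : Differentiable ℂ fun w : ℂ => omega1 (ell D ^ 30) w := by
      unfold omega1; fun_prop
    exact h1.mul h2
  unfold diffReg
  exact hds.mul ((hH.mul hE).differentiableOn)

/-- **The rectangle `[−1, 0] × [−V, V]`** (Cauchy's theorem for the regularised `I″`-integrand):
`∫_{−V}^{V} F(−1+iy)dy − ∫_{−V}^{V} F(iy)dy = −i(∫_{−1}^{0}F(x−iV)dx − ∫_{−1}^{0}F(x+iV)dx)` for
`0 < V < Im s`. [cite: Zhang2022LandauSiegel, §6 (6.5) p. 32 ("moving the segment `u = −1`,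
`|v| ≤ 𝓛²⁰` to `u = 0`, `|v| ≤ 𝓛²⁰`")] -/
theorem rect_diffReg {s : ℂ} {V : ℝ} (hV : 0 < V)
    (hVs : V < s.im) {X : ℝ} (hX : 0 < X) (hR : 0 < bigR D) (N : ℝ) :
    (∫ y in (-V)..V, diffReg χ x X N s ((-1 : ℝ) + y * I)) -
        (∫ y in (-V)..V, diffReg χ x X N s ((0 : ℝ) + y * I)) =
      -I * ((∫ u in (-1 : ℝ)..0, diffReg χ x X N s (u + (-V : ℝ) * I)) -
        ∫ u in (-1 : ℝ)..0, diffReg χ x X N s (u + (V : ℝ) * I)) := by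
  have hsim : 0 < s.im := lt_trans hV hVs
  have hd := differentiableOn_diffReg χ x hsim hX hR N
  set z : ℂ := (-1 : ℝ) + (-V : ℝ) * I with hz
  set w : ℂ := (0 : ℝ) + (V : ℝ) * I with hw
  have hzre : z.re = -1 := by simp [hz]
  have hzim : z.im = -V := by simp [hz]
  have hwre : w.re = 0 := by simp [hw]
  have hwim : w.im = V := by simp [hw]
  have hsub : (Set.uIcc z.re w.re ×ℂ Set.uIcc z.im w.im) ⊆ {w : ℂ | -s.im < w.im} := by
    intro q hq
    rw [hzre, hwre, hzim, hwim, Complex.mem_reProdIm] at hq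
    have h2 := hq.2
    rw [Set.uIcc_of_le (by linarith : -V ≤ V), Set.mem_Icc] at h2
    show -s.im < q.im
    linarith [h2.1]
  have h := Complex.integral_boundary_rect_eq_zero_of_differentiableOn (diffReg χ x X N s) z w
    (hd.mono hsub)
  rw [hzre, hwre, hzim, hwim] at h
  -- `h : Bot − Top + I•Mid − I•Left = 0`
  simp only [smul_eq_mul] at h
  have hI : I * I = -1 := Complex.I_mul_I
  linear_combination (I : ℂ) * h +
    ((∫ y in (-V)..V, diffReg χ x X N s ((-1 : ℝ) + y * I)) -
      ∫ y in (-V)..V, diffReg χ x X N s ((0 : ℝ) + y * I)) * hI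


end BlockF

end Literature.NumberTheory.LFunctions.Zhang2022.Section11AFE
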